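import Summits.QuantumFields.YangMills.Theorems.ColdStartUniversalityLatticeLangevinLiebRobinsonCorrelationLightConeFlow
import HarnessLib

/-!
# Route `ColdStartUniversality` (fixed-cut-off SZZ dynamics; LIEB–ROBINSON / LOCALITY package, file 35):
# ★★★ THE LIGHT CONE FOR DYNAMIC CORRELATIONS FROM EVERY DETERMINISTIC START — pointwise, separated and solution forms, EVERY coupling

Helper file (seat `ym-line-csu-p1`, g32; `--supports stmt-QuantumFields-24809`).  For the `SU(2)` lattice Langevin dynamics of Shen–Zhu–Zhu
on `(ℤ/L)³` at ANY coupling `β'` and any volume: a deterministic start (e.g. the COLD START `U_0 ≡ 1` of the route) is a product state, and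
along the dynamics correlations between distant observables are CREATED at most at the Lieb–Robinson speed.  From the integrated bound of
file 34 (`abs_integral_mul_transition_covariance_le`):
* ★ `nonpos_of_integral_testFunction_mul_nonpos` — the passage integrated ⇒ pointwise (test functions concentrating at a point; `μ_(β')`
  charges open sets), isolated from g29's `wilson_localPoincare_of_hessBound`;
* ★★★ `transition_covariance_abs_le_lightCone` — for `C³` `f, g` with link-Lipschitz profiles `ℓ^F, ℓ^G`, EVERY start `x`, every `t`:
  `|κ_t(FG)(x) − κ_tF(x)·κ_tG(x)| ≤ 16·t·e^(2λt)·S`, `S = Σ_e (Σ_e' ℓ^F_e' 108^(−D(e',e)))(Σ_e' ℓ^G_e' 108^(−D(e',e)))`, `λ = (1300+4√2)|β'|`;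
* `torusDist_le_add` (triangle inequality), ★ `overlapSum_le_of_separated` — profiles on link sets at cyclic sup-distance `≥ R+1` have
  overlap `S ≤ 6·2^(−(R+1))·Σℓ^F·Σℓ^G` (volume-free);
* ★★★ `transition_covariance_abs_le_lightCone_of_separated` — `|κ_t(FG)(x) − κ_tF(x)κ_tG(x)| ≤ 96·t·e^(2λt)·2^(−(R+1))·Σℓ^F·Σℓ^G` for EVERY
  start: exponentially small until the light cones of `F` and `G` (slope `2λ/log 2` links per unit lattice time) meet — NO volume factor, NO
  small-coupling window (compare file 18, `transition_covariance_abs_le_of_separated`: small for LARGE `t` at `|β'| < 1/12`; here: small for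
  SMALL `t` at every `β'` — the product structure of the initial state survives outside the light cone);
* ★★★ `solution_covariance_abs_le_lightCone_of_separated` — the same along every strong solution from a deterministic start on any filtered
  probability space (in particular the cold start).
THEOREMS ONLY, no definition, no sorry; [folklore] (Lieb–Robinson-type bounds on the creation of correlations from product states under local
dynamics).  HONEST FRAMING: fixed cut-off; the cone slope `λ ∝ |β'|` gives NO `K`-uniform locality in physical units along the route's scaling
`β'_K = (γε_K)⁻¹/2 → ∞`; `UniformColdStartMixing` (24809) is NOT restated; no crux, rung or summit statement is proved; the Yang–Mills mass gap
is NOT proved.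
-/

set_option autoImplicit false

noncomputable section

namespace Summit.QuantumFields.YangMills.Theorems.ColdStartUniversality.LiebRobinson

open MeasureTheory ProbabilityTheory Matrix Complex Finset Filter Set Metric intervalIntegral
open scoped ComplexConjugate BigOperators Matrix NNReal ENNReal Topology
open Literature.Probability.Process Literature.MathematicalPhysics.QuantumFieldTheory
open Literature.MathematicalPhysics.QuantumFieldTheory.Balaban1983to89
open Literature.MathematicalPhysics.QuantumLattice (fundamentalRep fundamentalLatticeRep continuous_fundamentalRep fundamentalRep_apply)

variable {L : ℕ} [NeZero L]

/-! ## §1. Concentrating the test function: from integrated to pointwise inequalities -/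

/-- ★ **Concentration of the test function.**  If `Φ` is a continuous function of the real link coordinates and
`∫ (h∘coords)·(Φ∘coords) dμ_(β') ≤ 0` for every `C³` compactly supported `h` with `h∘coords ≥ 0` on the group, then `Φ(coords x₀) ≤ 0` at EVERY
configuration `x₀` (smooth bump at `coords x₀` inside the open set `{Φ > 0}`; `μ_(β')` charges open sets, being equivalent to product Haar
measure).  The passage integrated ⇒ pointwise of g29 (`wilson_localPoincare_of_hessBound`), isolated. [folklore] -/
theorem nonpos_of_integral_testFunction_mul_nonpos (L : ℕ) [NeZero L] (β' : ℝ)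
    {Φ : (Edge 3 L × Fin 2 × Fin 2 × Bool → ℝ) → ℝ} (hΦ : Continuous Φ)
    (x₀ : (GaugeConfig 3 L (Matrix.specialUnitaryGroup (Fin 2) ℂ))) :
    let coords : GaugeConfig 3 L (Matrix.specialUnitaryGroup (Fin 2) ℂ) → (Edge 3 L × Fin 2 × Fin 2 × Bool → ℝ) :=
      fun V q => (fun z : ℂ => if q.2.2.2 then z.im else z.re)
        ((fundamentalRep (Fin 2) (V q.1) : Matrix (Fin 2) (Fin 2) ℂ) q.2.1 q.2.2.1)
    (∀ h : (Edge 3 L × Fin 2 × Fin 2 × Bool → ℝ) → ℝ, ContDiff ℝ 3 h → HasCompactSupport h → (∀ x, 0 ≤ h (coords x)) →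
      ∫ x, h (coords x) * Φ (coords x) ∂(wilsonMeasure (d := 3) (L := L) (fundamentalRep (Fin 2)) β') ≤ 0) →
    Φ (coords x₀) ≤ 0 := by
  intro coords hint
  classical
  haveI := secondCountableTopology_su2
  haveI := borelSpace_config L
  set μ : Measure (GaugeConfig 3 L (Matrix.specialUnitaryGroup (Fin 2) ℂ)) := (wilsonMeasure (d := 3) (L := L) (fundamentalRep (Fin 2)) β') with hμ
  haveI : IsProbabilityMeasure μ :=
    isProbabilityMeasure_wilsonMeasure (d := 3) (L := L) (fundamentalRep (Fin 2)) (continuous_fundamentalRep (Fin 2)) β'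
  have hco : Continuous coords := continuous_coords (L := L)
  by_contra hlt
  rw [not_le] at hlt
  have hO : IsOpen {y : (Edge 3 L × Fin 2 × Fin 2 × Bool → ℝ) | 0 < Φ y} := isOpen_lt continuous_const hΦ
  obtain ⟨ε, hε, hball⟩ := Metric.isOpen_iff.1 hO (coords x₀) hlt
  let χ : ContDiffBump (coords x₀) := ⟨ε / 4, ε / 2, by positivity, by linarith⟩
  have hχ3 : ContDiff ℝ 3 (χ : (Edge 3 L × Fin 2 × Fin 2 × Bool → ℝ) → ℝ) := χ.contDiff
  have hχ0 : ∀ x : (GaugeConfig 3 L (Matrix.specialUnitaryGroup (Fin 2) ℂ)), 0 ≤ (χ : (Edge 3 L × Fin 2 × Fin 2 × Bool → ℝ) → ℝ) (coords x) := fun x => χ.nonneg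
  have hprod0 : ∀ x : (GaugeConfig 3 L (Matrix.specialUnitaryGroup (Fin 2) ℂ)), 0 ≤ (χ : (Edge 3 L × Fin 2 × Fin 2 × Bool → ℝ) → ℝ) (coords x) * Φ (coords x) := by
    intro x
    by_cases hz : (χ : (Edge 3 L × Fin 2 × Fin 2 × Bool → ℝ) → ℝ) (coords x) = 0
    · rw [hz, zero_mul]
    · have hmem : coords x ∈ Function.support (χ : (Edge 3 L × Fin 2 × Fin 2 × Bool → ℝ) → ℝ) := hz
      rw [χ.support_eq] at hmem
      have hin : coords x ∈ ball (coords x₀) ε := ball_subset_ball (by show χ.rOut ≤ ε; simp only [χ]; linarith) hmem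
      exact mul_nonneg χ.nonneg (le_of_lt (hball hin))
  have hpos0 : 0 < (χ : (Edge 3 L × Fin 2 × Fin 2 × Bool → ℝ) → ℝ) (coords x₀) * Φ (coords x₀) := by
    rw [χ.one_of_mem_closedBall (mem_closedBall_self (by show (0 : ℝ) ≤ χ.rIn; simp only [χ]; positivity)), one_mul]
    exact hlt
  have cP : Continuous fun x : (GaugeConfig 3 L (Matrix.specialUnitaryGroup (Fin 2) ℂ)) => (χ : (Edge 3 L × Fin 2 × Fin 2 × Bool → ℝ) → ℝ) (coords x) * Φ (coords x) :=
    (χ.continuous.comp hco).mul (hΦ.comp hco)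
  set π : Measure (GaugeConfig 3 L (Matrix.specialUnitaryGroup (Fin 2) ℂ)) := Measure.pi fun _ : Edge 3 L => haarProbability (Matrix.specialUnitaryGroup (Fin 2) ℂ) with hπ
  haveI : π.IsOpenPosMeasure := by
    rw [hπ]
    haveI : ∀ _e : Edge 3 L, (haarProbability (Matrix.specialUnitaryGroup (Fin 2) ℂ)).IsOpenPosMeasure := fun _ => by
      unfold haarProbability; infer_instance
    infer_instance
  have hπμ : π ≪ μ := by
    rw [hμ, Literature.MathematicalPhysics.QuantumLattice.wilsonMeasure_eq_tilted_pi (fundamentalRep (Fin 2))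
      (continuous_fundamentalRep (n := Fin 2)) β', ← hπ]
    refine absolutelyContinuous_tilted ?_
    obtain ⟨B, hB⟩ := exists_abs_wilsonAction_le (d := 3) (L := L) (fundamentalRep (Fin 2)) (continuous_fundamentalRep (Fin 2))
    refine Integrable.of_bound (((measurable_wilsonAction (d := 3) (L := L) (fundamentalRep (Fin 2)) (continuous_fundamentalRep (Fin 2))).const_mul _).exp).aestronglyMeasurable
      (Real.exp (|β'| * B)) (ae_of_all _ fun U => ?_)
    rw [Real.norm_eq_abs, Real.abs_exp, Real.exp_le_exp]
    have h1 : |β' * wilsonAction (fundamentalRep (Fin 2)) U| ≤ |β'| * B := by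
      rw [abs_mul]; exact mul_le_mul_of_nonneg_left (hB U) (abs_nonneg _)
    have h2 := (abs_le.1 h1).1
    linarith
  have hIpos : 0 < ∫ x, (χ : (Edge 3 L × Fin 2 × Fin 2 × Bool → ℝ) → ℝ) (coords x) * Φ (coords x) ∂μ := by
    rw [integral_pos_iff_support_of_nonneg (fun x => hprod0 x) (integrable_of_continuous_of_compactSpace cP μ)]
    have hU : IsOpen {x : (GaugeConfig 3 L (Matrix.specialUnitaryGroup (Fin 2) ℂ)) | 0 < (χ : (Edge 3 L × Fin 2 × Fin 2 × Bool → ℝ) → ℝ) (coords x) * Φ (coords x)} := isOpen_lt continuous_const cP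
    have hUπ : 0 < π {x : (GaugeConfig 3 L (Matrix.specialUnitaryGroup (Fin 2) ℂ)) | 0 < (χ : (Edge 3 L × Fin 2 × Fin 2 × Bool → ℝ) → ℝ) (coords x) * Φ (coords x)} := hU.measure_pos π ⟨x₀, hpos0⟩
    have hUμ : 0 < μ {x : (GaugeConfig 3 L (Matrix.specialUnitaryGroup (Fin 2) ℂ)) | 0 < (χ : (Edge 3 L × Fin 2 × Fin 2 × Bool → ℝ) → ℝ) (coords x) * Φ (coords x)} :=
      pos_iff_ne_zero.2 fun h0 => hUπ.ne' (hπμ h0)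
    exact hUμ.trans_le (measure_mono fun x hx => ne_of_gt hx)
  exact absurd (hint χ hχ3 χ.hasCompactSupport hχ0) (not_le.2 hIpos)

/-! ## §2. The pointwise light cone: every deterministic start -/

/-- ★★★ **Light cone for dynamic correlations from EVERY deterministic start (every coupling `β'`, every volume `L`).**  For `C³`
functions `f, g` of the real link coordinates whose pull-backs `F = f∘coords`, `G = g∘coords` have link-Lipschitz profiles `ℓ^F, ℓ^G ≥ 0`,
any realising Markov kernel family `κ`, every lattice time `t` and EVERY configuration `x` (e.g. the cold start):
`|κ_t(FG)(x) − κ_tF(x)·κ_tG(x)| ≤ 16·t·e^(2λt)·S`, `λ = |β'|(4+4√2+12·108)`, `S = Σ_e (Σ_e' ℓ^F_e' 108^(−D(e',e)))(Σ_e' ℓ^G_e' 108^(−D(e',e)))`: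
the covariance of `F(U_t)` and `G(U_t)` along the dynamics started at the point `x` is bounded by the overlap of the two light cones.
Proof: cut-off of `f, g` outside the range of `coords`; `C³` representatives of `κ_t(FG)`, `κ_tF`, `κ_tG` (`transitionKernel_preserves_dynkinClass`);
the integrated bound (file 34) for every test function; `nonpos_of_integral_testFunction_mul_nonpos`. [folklore] -/
theorem transition_covariance_abs_le_lightCone (L : ℕ) [NeZero L] (β' : ℝ)
    (κ : ℝ≥0 → Kernel (GaugeConfig 3 L (Matrix.specialUnitaryGroup (Fin 2) ℂ))
      (GaugeConfig 3 L (Matrix.specialUnitaryGroup (Fin 2) ℂ))) [∀ t, IsMarkovKernel (κ t)]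
    (hreal : ∀ (t : ℝ≥0) (x : GaugeConfig 3 L (Matrix.specialUnitaryGroup (Fin 2) ℂ))
        (Ω : Type) [MeasurableSpace Ω] (P : Measure Ω) [IsProbabilityMeasure P]
        (W : ℝ≥0 → Ω → (Edge 3 L × NoiseIdx 2 → ℝ)) (hW : IsFlatBrownian W P)
        (U : ℝ≥0 → Ω → GaugeConfig 3 L (Matrix.specialUnitaryGroup (Fin 2) ℂ)),
        (∀ ω, U 0 ω = x) →
        (latticeLangevinDynamics (fundamentalLatticeRep 2) β').IsSolution (fundamentalRep (Fin 2))
          hW.natFiltration P W U →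
        κ t x = P.map (U t))
    {f : (Edge 3 L × Fin 2 × Fin 2 × Bool → ℝ) → ℝ} (hf : ContDiff ℝ 3 f) {ℓF : Edge 3 L → ℝ} (hℓF : ∀ e, 0 ≤ ℓF e)
    {g : (Edge 3 L × Fin 2 × Fin 2 × Bool → ℝ) → ℝ} (hg : ContDiff ℝ 3 g) {ℓG : Edge 3 L → ℝ} (hℓG : ∀ e, 0 ≤ ℓG e)
    (t : ℝ≥0) (x : (GaugeConfig 3 L (Matrix.specialUnitaryGroup (Fin 2) ℂ))) :
    let coords : GaugeConfig 3 L (Matrix.specialUnitaryGroup (Fin 2) ℂ) → (Edge 3 L × Fin 2 × Fin 2 × Bool → ℝ) :=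
      fun V q => (fun z : ℂ => if q.2.2.2 then z.im else z.re)
        ((fundamentalRep (Fin 2) (V q.1) : Matrix (Fin 2) (Fin 2) ℂ) q.2.1 q.2.2.1)
    (∀ (e : Edge 3 L) (y y' : (GaugeConfig 3 L (Matrix.specialUnitaryGroup (Fin 2) ℂ))), (∀ f', f' ≠ e → y f' = y' f') →
      |f (coords y) - f (coords y')| ≤ ℓF e * frobNorm ((y e : Matrix (Fin 2) (Fin 2) ℂ) - (y' e : Matrix (Fin 2) (Fin 2) ℂ))) →
    (∀ (e : Edge 3 L) (y y' : (GaugeConfig 3 L (Matrix.specialUnitaryGroup (Fin 2) ℂ))), (∀ f', f' ≠ e → y f' = y' f') →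
      |g (coords y) - g (coords y')| ≤ ℓG e * frobNorm ((y e : Matrix (Fin 2) (Fin 2) ℂ) - (y' e : Matrix (Fin 2) (Fin 2) ℂ))) →
    |(∫ y, f (coords y) * g (coords y) ∂(κ t x)) - (∫ y, f (coords y) ∂(κ t x)) * (∫ y, g (coords y) ∂(κ t x))| ≤
      16 * (t : ℝ) * Real.exp (2 * ((|β'| * (4 + 4 * Real.sqrt 2 + 12 * 108)) * (t : ℝ))) * (∑ e : Edge 3 L, (∑ e' : Edge 3 L, ℓF e' * ((108 : ℝ)⁻¹) ^ (Finset.univ.sup fun i : Fin 3 => ((e'.1 i - e.1 i).valMinAbs).natAbs)) * (∑ e' : Edge 3 L, ℓG e' * ((108 : ℝ)⁻¹) ^ (Finset.univ.sup fun i : Fin 3 => ((e'.1 i - e.1 i).valMinAbs).natAbs))) := by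
  intro coords hLf hLg
  classical
  haveI := secondCountableTopology_su2
  haveI := borelSpace_config L
  set μ : Measure (GaugeConfig 3 L (Matrix.specialUnitaryGroup (Fin 2) ℂ)) := (wilsonMeasure (d := 3) (L := L) (fundamentalRep (Fin 2)) β') with hμ
  haveI : IsProbabilityMeasure μ :=
    isProbabilityMeasure_wilsonMeasure (d := 3) (L := L) (fundamentalRep (Fin 2)) (continuous_fundamentalRep (Fin 2)) β'
  have hco : Continuous coords := continuous_coords (L := L)
  have hInt : ∀ {Ψ : (GaugeConfig 3 L (Matrix.specialUnitaryGroup (Fin 2) ℂ)) → ℝ}, Continuous Ψ → Integrable Ψ μ := fun hΨ => integrable_of_continuous_of_compactSpace hΨ μ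
  set B : ℝ := 16 * (t : ℝ) * Real.exp (2 * ((|β'| * (4 + 4 * Real.sqrt 2 + 12 * 108)) * (t : ℝ))) * (∑ e : Edge 3 L, (∑ e' : Edge 3 L, ℓF e' * ((108 : ℝ)⁻¹) ^ (Finset.univ.sup fun i : Fin 3 => ((e'.1 i - e.1 i).valMinAbs).natAbs)) * (∑ e' : Edge 3 L, ℓG e' * ((108 : ℝ)⁻¹) ^ (Finset.univ.sup fun i : Fin 3 => ((e'.1 i - e.1 i).valMinAbs).natAbs))) with hB
  -- §1 cut-off of `f`, `g` (all values of `coords` lie in the closed unit ball)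
  obtain ⟨f₁, hf₁, hf₁c, hf₁eq⟩ := exists_contDiff_hasCompactSupport_eqOn (n := 3) hf 1
  obtain ⟨g₁, hg₁, hg₁c, hg₁eq⟩ := exists_contDiff_hasCompactSupport_eqOn (n := 3) hg 1
  have hfv : ∀ y : (GaugeConfig 3 L (Matrix.specialUnitaryGroup (Fin 2) ℂ)), f₁ (coords y) = f (coords y) := fun y => (hf₁eq _ (norm_coords_le_one y)).self_of_nhds
  have hgv : ∀ y : (GaugeConfig 3 L (Matrix.specialUnitaryGroup (Fin 2) ℂ)), g₁ (coords y) = g (coords y) := fun y => (hg₁eq _ (norm_coords_le_one y)).self_of_nhds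
  have hLf₁ : ∀ (e : Edge 3 L) (y y' : (GaugeConfig 3 L (Matrix.specialUnitaryGroup (Fin 2) ℂ))), (∀ f', f' ≠ e → y f' = y' f') →
      |f₁ (coords y) - f₁ (coords y')| ≤ ℓF e * frobNorm ((y e : Matrix (Fin 2) (Fin 2) ℂ) - (y' e : Matrix (Fin 2) (Fin 2) ℂ)) := by
    intro e y y' hyy'; rw [hfv y, hfv y']; exact hLf e y y' hyy'
  have hLg₁ : ∀ (e : Edge 3 L) (y y' : (GaugeConfig 3 L (Matrix.specialUnitaryGroup (Fin 2) ℂ))), (∀ f', f' ≠ e → y f' = y' f') →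
      |g₁ (coords y) - g₁ (coords y')| ≤ ℓG e * frobNorm ((y e : Matrix (Fin 2) (Fin 2) ℂ) - (y' e : Matrix (Fin 2) (Fin 2) ℂ)) := by
    intro e y y' hyy'; rw [hgv y, hgv y']; exact hLg e y y' hyy'
  -- §2 continuous representatives of the three kernel quantities
  obtain ⟨p2, hp2, -, hp2rep⟩ := transitionKernel_preserves_dynkinClass L β' κ hreal t (hf₁.mul hg₁)
  obtain ⟨pf, hpf, -, hpfrep⟩ := transitionKernel_preserves_dynkinClass L β' κ hreal t hf₁
  obtain ⟨pg, hpg, -, hpgrep⟩ := transitionKernel_preserves_dynkinClass L β' κ hreal t hg₁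
  have hP2 : ∀ y : (GaugeConfig 3 L (Matrix.specialUnitaryGroup (Fin 2) ℂ)), ∫ z, f₁ (coords z) * g₁ (coords z) ∂(κ t y) = p2 (coords y) := fun y => hp2rep y
  have hPf : ∀ y : (GaugeConfig 3 L (Matrix.specialUnitaryGroup (Fin 2) ℂ)), ∫ z, f₁ (coords z) ∂(κ t y) = pf (coords y) := fun y => hpfrep y
  have hPg : ∀ y : (GaugeConfig 3 L (Matrix.specialUnitaryGroup (Fin 2) ℂ)), ∫ z, g₁ (coords z) ∂(κ t y) = pg (coords y) := fun y => hpgrep y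
  -- §3 both one-sided functions `±(p2 − pf·pg) − B` integrate nonpositively against every test function
  have hflow := fun (h : (Edge 3 L × Fin 2 × Fin 2 × Bool → ℝ) → ℝ) (hh : ContDiff ℝ 3 h) (hhc : HasCompactSupport h)
      (hh0 : ∀ y : (GaugeConfig 3 L (Matrix.specialUnitaryGroup (Fin 2) ℂ)), 0 ≤ h (coords y)) =>
    abs_integral_mul_transition_covariance_le L β' κ hreal hf₁ hf₁c hℓF hg₁ hg₁c hℓG hh hhc t hh0 hLf₁ hLg₁
  have hside : ∀ (s : ℝ), (s = 1 ∨ s = -1) → ∀ x₀ : (GaugeConfig 3 L (Matrix.specialUnitaryGroup (Fin 2) ℂ)),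
      (fun z => s * (p2 z - pf z * pg z) - B) (coords x₀) ≤ 0 := by
    intro s hs x₀
    have hΦc : Continuous fun z => s * (p2 z - pf z * pg z) - B :=
      (continuous_const.mul (hp2.continuous.sub (hpf.continuous.mul hpg.continuous))).sub continuous_const
    refine nonpos_of_integral_testFunction_mul_nonpos L β' hΦc x₀ fun h hh hhc hh0 => ?_
    have hb := hflow h hh hhc hh0
    have cH : Continuous fun y : (GaugeConfig 3 L (Matrix.specialUnitaryGroup (Fin 2) ℂ)) => h (coords y) := hh.continuous.comp hco
    have c2 : Continuous fun y : (GaugeConfig 3 L (Matrix.specialUnitaryGroup (Fin 2) ℂ)) => p2 (coords y) := hp2.continuous.comp hco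
    have cf : Continuous fun y : (GaugeConfig 3 L (Matrix.specialUnitaryGroup (Fin 2) ℂ)) => pf (coords y) := hpf.continuous.comp hco
    have cg : Continuous fun y : (GaugeConfig 3 L (Matrix.specialUnitaryGroup (Fin 2) ℂ)) => pg (coords y) := hpg.continuous.comp hco
    have i1 : Integrable (fun y => h (coords y) * p2 (coords y)) μ := hInt (cH.mul c2)
    have i2 : Integrable (fun y => h (coords y) * (pf (coords y) * pg (coords y))) μ := hInt (cH.mul (cf.mul cg))
    have i3 : Integrable (fun y => B * h (coords y)) μ := (hInt cH).const_mul B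
    have e1 : ∫ y, h (coords y) * (∫ z, f₁ (coords z) * g₁ (coords z) ∂(κ t y)) ∂μ = ∫ y, h (coords y) * p2 (coords y) ∂μ :=
      integral_congr_ae (ae_of_all _ fun y => by simp only [hP2 y])
    have e2 : ∫ y, h (coords y) * ((∫ z, f₁ (coords z) ∂(κ t y)) * (∫ z, g₁ (coords z) ∂(κ t y))) ∂μ = ∫ y, h (coords y) * (pf (coords y) * pg (coords y)) ∂μ :=
      integral_congr_ae (ae_of_all _ fun y => by simp only [hPf y, hPg y])
    rw [e1, e2] at hb
    have e3 : ∫ y, h (coords y) * ((fun z => s * (p2 z - pf z * pg z) - B) (coords y)) ∂μ =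
        s * (∫ y, h (coords y) * p2 (coords y) ∂μ - ∫ y, h (coords y) * (pf (coords y) * pg (coords y)) ∂μ) - B * ∫ y, h (coords y) ∂μ := by
      have i4 : Integrable (fun y => s * (h (coords y) * p2 (coords y) - h (coords y) * (pf (coords y) * pg (coords y)))) μ := (i1.sub i2).const_mul s
      rw [← integral_sub i1 i2, ← MeasureTheory.integral_const_mul, ← MeasureTheory.integral_const_mul, ← integral_sub i4 i3]
      refine integral_congr_ae (ae_of_all _ fun y => ?_)
      show h (coords y) * (s * (p2 (coords y) - pf (coords y) * pg (coords y)) - B) = _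
      ring
    rw [e3]
    have hB' : B * ∫ y, h (coords y) ∂μ = 16 * (t : ℝ) * Real.exp (2 * ((|β'| * (4 + 4 * Real.sqrt 2 + 12 * 108)) * (t : ℝ))) * (∑ e : Edge 3 L, (∑ e' : Edge 3 L, ℓF e' * ((108 : ℝ)⁻¹) ^ (Finset.univ.sup fun i : Fin 3 => ((e'.1 i - e.1 i).valMinAbs).natAbs)) * (∑ e' : Edge 3 L, ℓG e' * ((108 : ℝ)⁻¹) ^ (Finset.univ.sup fun i : Fin 3 => ((e'.1 i - e.1 i).valMinAbs).natAbs))) * ∫ y, h (coords y) ∂μ := by rw [hB]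
    rcases hs with hs1 | hs1 <;> rw [hs1]
    · have := (abs_le.1 hb).2; linarith
    · have := (abs_le.1 hb).1; linarith
  -- §4 read off at `x`
  have h1 := hside 1 (Or.inl rfl) x
  have h2 := hside (-1) (Or.inr rfl) x
  simp only at h1 h2
  have eP2 : ∫ y, f (coords y) * g (coords y) ∂(κ t x) = p2 (coords x) := by
    rw [← hP2 x]; exact integral_congr_ae (ae_of_all _ fun y => by simp only [hfv y, hgv y])
  have ePf : ∫ y, f (coords y) ∂(κ t x) = pf (coords x) := by
    rw [← hPf x]; exact integral_congr_ae (ae_of_all _ fun y => by simp only [hfv y])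
  have ePg : ∫ y, g (coords y) ∂(κ t x) = pg (coords x) := by
    rw [← hPg x]; exact integral_congr_ae (ae_of_all _ fun y => by simp only [hgv y])
  rw [eP2, ePf, ePg, abs_le]
  constructor <;> linarith

/-! ## §3. Geometry: the overlap of two separated light cones -/

omit [NeZero L] in
/-- **Triangle inequality for the cyclic sup-distance of base sites**: `D(a,b) ≤ D(a,e) + D(b,e)`. [folklore] -/
theorem torusDist_le_add (a b e : Edge 3 L) :
    (Finset.univ.sup fun i : Fin 3 => ((a.1 i - b.1 i).valMinAbs).natAbs) ≤ (Finset.univ.sup fun i : Fin 3 => ((a.1 i - e.1 i).valMinAbs).natAbs) + (Finset.univ.sup fun i : Fin 3 => ((b.1 i - e.1 i).valMinAbs).natAbs) := by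
  refine Finset.sup_le fun i _ => ?_
  have h1 : a.1 i - b.1 i = (a.1 i - e.1 i) + (-(b.1 i - e.1 i)) := by ring
  rw [h1]
  calc (((a.1 i - e.1 i) + (-(b.1 i - e.1 i))).valMinAbs).natAbs
      ≤ ((a.1 i - e.1 i).valMinAbs).natAbs + ((-(b.1 i - e.1 i)).valMinAbs).natAbs := natAbs_valMinAbs_add_le' _ _
    _ = ((a.1 i - e.1 i).valMinAbs).natAbs + ((b.1 i - e.1 i).valMinAbs).natAbs := by rw [ZMod.natAbs_valMinAbs_neg]
    _ ≤ (Finset.univ.sup fun i : Fin 3 => ((a.1 i - e.1 i).valMinAbs).natAbs) + (Finset.univ.sup fun i : Fin 3 => ((b.1 i - e.1 i).valMinAbs).natAbs) :=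
        add_le_add (Finset.le_sup (f := fun i : Fin 3 => ((a.1 i - e.1 i).valMinAbs).natAbs) (Finset.mem_univ i))
          (Finset.le_sup (f := fun i : Fin 3 => ((b.1 i - e.1 i).valMinAbs).natAbs) (Finset.mem_univ i))

/-- ★ **The overlap of two separated light cones.**  If `ℓ^F ≥ 0` vanishes off `Λ_F`, `ℓ^G ≥ 0` off `Λ_G`, and the base sites of `Λ_F` and `Λ_G`
are at cyclic sup-distance `≥ R+1`, then `S = Σ_e (Σ_e' ℓ^F_e' 108^(−D(e',e)))·(Σ_e' ℓ^G_e' 108^(−D(e',e))) ≤ 6·2^(−(R+1))·Σℓ^F·Σℓ^G`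
(triangle inequality `D(a,b) ≤ D(a,e) + D(b,e)`, `108^(−m)·108^(−n) ≤ 2^(−(m+n))·54^(−n)`, and the volume-free sum `Σ_e 54^(−D) ≤ 6`). [folklore] -/
theorem overlapSum_le_of_separated {ℓF ℓG : Edge 3 L → ℝ} (hℓF : ∀ e, 0 ≤ ℓF e) (hℓG : ∀ e, 0 ≤ ℓG e)
    (Λf Λg : Finset (Edge 3 L)) (hΛf : ∀ e, e ∉ Λf → ℓF e = 0) (hΛg : ∀ e, e ∉ Λg → ℓG e = 0) (R : ℕ)
    (hsep : ∀ e' ∈ Λf, ∀ e ∈ Λg, R + 1 ≤ (Finset.univ.sup fun i : Fin 3 => ((e'.1 i - e.1 i).valMinAbs).natAbs)) :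
    (∑ e : Edge 3 L, (∑ e' : Edge 3 L, ℓF e' * ((108 : ℝ)⁻¹) ^ (Finset.univ.sup fun i : Fin 3 => ((e'.1 i - e.1 i).valMinAbs).natAbs)) * (∑ e' : Edge 3 L, ℓG e' * ((108 : ℝ)⁻¹) ^ (Finset.univ.sup fun i : Fin 3 => ((e'.1 i - e.1 i).valMinAbs).natAbs))) ≤ 6 * ((2 : ℝ)⁻¹) ^ (R + 1) * ((∑ e : Edge 3 L, ℓF e) * ∑ e : Edge 3 L, ℓG e) := by
  classical
  -- termwise bound
  have hterm : ∀ (e a b : Edge 3 L), ℓF a * ((108 : ℝ)⁻¹) ^ (Finset.univ.sup fun i : Fin 3 => ((a.1 i - e.1 i).valMinAbs).natAbs) * (ℓG b * ((108 : ℝ)⁻¹) ^ (Finset.univ.sup fun i : Fin 3 => ((b.1 i - e.1 i).valMinAbs).natAbs)) ≤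
      ((2 : ℝ)⁻¹) ^ (R + 1) * (ℓF a * (ℓG b * ((54 : ℝ)⁻¹) ^ (Finset.univ.sup fun i : Fin 3 => ((b.1 i - e.1 i).valMinAbs).natAbs))) := by
    intro e a b
    by_cases ha : a ∈ Λf
    · by_cases hb : b ∈ Λg
      · have hRle : R + 1 ≤ (Finset.univ.sup fun i : Fin 3 => ((a.1 i - e.1 i).valMinAbs).natAbs) + (Finset.univ.sup fun i : Fin 3 => ((b.1 i - e.1 i).valMinAbs).natAbs) := (hsep a ha b hb).trans (torusDist_le_add a b e)
        have h1 : ((108 : ℝ)⁻¹) ^ (Finset.univ.sup fun i : Fin 3 => ((a.1 i - e.1 i).valMinAbs).natAbs) ≤ ((2 : ℝ)⁻¹) ^ (Finset.univ.sup fun i : Fin 3 => ((a.1 i - e.1 i).valMinAbs).natAbs) :=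
          pow_le_pow_left₀ (by norm_num) (by norm_num) _
        have h2 : ((108 : ℝ)⁻¹) ^ (Finset.univ.sup fun i : Fin 3 => ((b.1 i - e.1 i).valMinAbs).natAbs) = ((2 : ℝ)⁻¹) ^ (Finset.univ.sup fun i : Fin 3 => ((b.1 i - e.1 i).valMinAbs).natAbs) * ((54 : ℝ)⁻¹) ^ (Finset.univ.sup fun i : Fin 3 => ((b.1 i - e.1 i).valMinAbs).natAbs) := by
          rw [← mul_pow]; norm_num
        have h3 : ((2 : ℝ)⁻¹) ^ (Finset.univ.sup fun i : Fin 3 => ((a.1 i - e.1 i).valMinAbs).natAbs) * ((2 : ℝ)⁻¹) ^ (Finset.univ.sup fun i : Fin 3 => ((b.1 i - e.1 i).valMinAbs).natAbs) ≤ ((2 : ℝ)⁻¹) ^ (R + 1) := by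
          rw [← pow_add]; exact pow_le_pow_of_le_one (by norm_num) (by norm_num) hRle
        have h4 : ((108 : ℝ)⁻¹) ^ (Finset.univ.sup fun i : Fin 3 => ((a.1 i - e.1 i).valMinAbs).natAbs) * ((108 : ℝ)⁻¹) ^ (Finset.univ.sup fun i : Fin 3 => ((b.1 i - e.1 i).valMinAbs).natAbs) ≤ ((2 : ℝ)⁻¹) ^ (R + 1) * ((54 : ℝ)⁻¹) ^ (Finset.univ.sup fun i : Fin 3 => ((b.1 i - e.1 i).valMinAbs).natAbs) := by
          rw [h2, ← mul_assoc]
          exact mul_le_mul_of_nonneg_right (le_trans (mul_le_mul_of_nonneg_right h1 (by positivity)) h3) (by positivity)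
        have h5 := mul_le_mul_of_nonneg_left h4 (mul_nonneg (hℓF a) (hℓG b))
        calc ℓF a * ((108 : ℝ)⁻¹) ^ (Finset.univ.sup fun i : Fin 3 => ((a.1 i - e.1 i).valMinAbs).natAbs) * (ℓG b * ((108 : ℝ)⁻¹) ^ (Finset.univ.sup fun i : Fin 3 => ((b.1 i - e.1 i).valMinAbs).natAbs))
            = ℓF a * ℓG b * (((108 : ℝ)⁻¹) ^ (Finset.univ.sup fun i : Fin 3 => ((a.1 i - e.1 i).valMinAbs).natAbs) * ((108 : ℝ)⁻¹) ^ (Finset.univ.sup fun i : Fin 3 => ((b.1 i - e.1 i).valMinAbs).natAbs)) := by ring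
          _ ≤ ℓF a * ℓG b * (((2 : ℝ)⁻¹) ^ (R + 1) * ((54 : ℝ)⁻¹) ^ (Finset.univ.sup fun i : Fin 3 => ((b.1 i - e.1 i).valMinAbs).natAbs)) := h5
          _ = _ := by ring
      · rw [hΛg b hb]; simp
    · rw [hΛf a ha]; simp
  -- per-link bound
  have hMe : ∀ e : Edge 3 L, (∑ e' : Edge 3 L, ℓF e' * ((108 : ℝ)⁻¹) ^ (Finset.univ.sup fun i : Fin 3 => ((e'.1 i - e.1 i).valMinAbs).natAbs)) * (∑ e' : Edge 3 L, ℓG e' * ((108 : ℝ)⁻¹) ^ (Finset.univ.sup fun i : Fin 3 => ((e'.1 i - e.1 i).valMinAbs).natAbs)) ≤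
      ((2 : ℝ)⁻¹) ^ (R + 1) * ((∑ a : Edge 3 L, ℓF a) * ∑ b : Edge 3 L, ℓG b * ((54 : ℝ)⁻¹) ^ (Finset.univ.sup fun i : Fin 3 => ((b.1 i - e.1 i).valMinAbs).natAbs)) := by
    intro e
    rw [Finset.sum_mul_sum, Finset.sum_mul, Finset.mul_sum]
    refine Finset.sum_le_sum fun a _ => ?_
    rw [Finset.mul_sum, Finset.mul_sum]
    refine Finset.sum_le_sum fun b _ => ?_
    calc ℓF a * ((108 : ℝ)⁻¹) ^ (Finset.univ.sup fun i : Fin 3 => ((a.1 i - e.1 i).valMinAbs).natAbs) * (ℓG b * ((108 : ℝ)⁻¹) ^ (Finset.univ.sup fun i : Fin 3 => ((b.1 i - e.1 i).valMinAbs).natAbs))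
        ≤ ((2 : ℝ)⁻¹) ^ (R + 1) * (ℓF a * (ℓG b * ((54 : ℝ)⁻¹) ^ (Finset.univ.sup fun i : Fin 3 => ((b.1 i - e.1 i).valMinAbs).natAbs))) := hterm e a b
      _ = _ := by ring
  -- the volume-free sum over `e`
  have hsumG : ∑ e : Edge 3 L, ∑ b : Edge 3 L, ℓG b * ((54 : ℝ)⁻¹) ^ (Finset.univ.sup fun i : Fin 3 => ((b.1 i - e.1 i).valMinAbs).natAbs) ≤ 6 * ∑ b : Edge 3 L, ℓG b := by
    rw [Finset.sum_comm, Finset.mul_sum]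
    refine Finset.sum_le_sum fun b _ => ?_
    rw [← Finset.mul_sum, mul_comm (6 : ℝ)]
    refine mul_le_mul_of_nonneg_left ?_ (hℓG b)
    have h6 := sum_edge_pow_torusDist_le (L := L) b.1
    calc ∑ e : Edge 3 L, ((54 : ℝ)⁻¹) ^ (Finset.univ.sup fun i : Fin 3 => ((b.1 i - e.1 i).valMinAbs).natAbs) = ∑ e : Edge 3 L, ((54 : ℝ)⁻¹) ^ (Finset.univ.sup fun i : Fin 3 => ((e.1 i - b.1 i).valMinAbs).natAbs) :=
          Finset.sum_congr rfl fun e _ => by rw [torusDist_comm e.1 b.1]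
      _ ≤ 6 := h6
  calc (∑ e : Edge 3 L, (∑ e' : Edge 3 L, ℓF e' * ((108 : ℝ)⁻¹) ^ (Finset.univ.sup fun i : Fin 3 => ((e'.1 i - e.1 i).valMinAbs).natAbs)) * (∑ e' : Edge 3 L, ℓG e' * ((108 : ℝ)⁻¹) ^ (Finset.univ.sup fun i : Fin 3 => ((e'.1 i - e.1 i).valMinAbs).natAbs)))
      ≤ ∑ e : Edge 3 L, ((2 : ℝ)⁻¹) ^ (R + 1) * ((∑ a : Edge 3 L, ℓF a) * ∑ b : Edge 3 L, ℓG b * ((54 : ℝ)⁻¹) ^ (Finset.univ.sup fun i : Fin 3 => ((b.1 i - e.1 i).valMinAbs).natAbs)) :=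
        Finset.sum_le_sum fun e _ => hMe e
    _ = ((2 : ℝ)⁻¹) ^ (R + 1) * (∑ a : Edge 3 L, ℓF a) * ∑ e : Edge 3 L, ∑ b : Edge 3 L, ℓG b * ((54 : ℝ)⁻¹) ^ (Finset.univ.sup fun i : Fin 3 => ((b.1 i - e.1 i).valMinAbs).natAbs) := by
        rw [Finset.mul_sum]; exact Finset.sum_congr rfl fun e _ => by ring
    _ ≤ ((2 : ℝ)⁻¹) ^ (R + 1) * (∑ a : Edge 3 L, ℓF a) * (6 * ∑ b : Edge 3 L, ℓG b) :=
        mul_le_mul_of_nonneg_left hsumG (mul_nonneg (by positivity) (Finset.sum_nonneg fun a _ => hℓF a))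
    _ = _ := by ring

/-! ## §4. Separated observables: exponentially small correlations before the light cones meet -/

/-- ★★★ **Dynamic correlations of separated observables from EVERY deterministic start (every coupling, every volume).**  With the
notation of `transition_covariance_abs_le_lightCone`, if the profiles `ℓ^F, ℓ^G` are supported on link sets `Λ_F, Λ_G` whose base sites are at
cyclic sup-distance `≥ R+1`, then for every realising kernel family, every lattice time `t` and EVERY start `x`:
`|κ_t(FG)(x) − κ_tF(x)·κ_tG(x)| ≤ 96·t·e^(2λt)·2^(−(R+1))·Σℓ^F·Σℓ^G`, `λ = (1300+4√2)|β'|` — started from a point (e.g. the COLD START), the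
observables `F(U_t)`, `G(U_t)` stay uncorrelated up to an error `t·e^(2λt − (R+1) log 2)`: correlations are created at most at the speed
`2λ/log 2` links per unit lattice time, uniformly in `L`, at EVERY coupling. [folklore] -/
theorem transition_covariance_abs_le_lightCone_of_separated (L : ℕ) [NeZero L] (β' : ℝ)
    (κ : ℝ≥0 → Kernel (GaugeConfig 3 L (Matrix.specialUnitaryGroup (Fin 2) ℂ))
      (GaugeConfig 3 L (Matrix.specialUnitaryGroup (Fin 2) ℂ))) [∀ t, IsMarkovKernel (κ t)]
    (hreal : ∀ (t : ℝ≥0) (x : GaugeConfig 3 L (Matrix.specialUnitaryGroup (Fin 2) ℂ))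
        (Ω : Type) [MeasurableSpace Ω] (P : Measure Ω) [IsProbabilityMeasure P]
        (W : ℝ≥0 → Ω → (Edge 3 L × NoiseIdx 2 → ℝ)) (hW : IsFlatBrownian W P)
        (U : ℝ≥0 → Ω → GaugeConfig 3 L (Matrix.specialUnitaryGroup (Fin 2) ℂ)),
        (∀ ω, U 0 ω = x) →
        (latticeLangevinDynamics (fundamentalLatticeRep 2) β').IsSolution (fundamentalRep (Fin 2))
          hW.natFiltration P W U →
        κ t x = P.map (U t))
    {f : (Edge 3 L × Fin 2 × Fin 2 × Bool → ℝ) → ℝ} (hf : ContDiff ℝ 3 f) {ℓF : Edge 3 L → ℝ} (hℓF : ∀ e, 0 ≤ ℓF e)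
    {g : (Edge 3 L × Fin 2 × Fin 2 × Bool → ℝ) → ℝ} (hg : ContDiff ℝ 3 g) {ℓG : Edge 3 L → ℝ} (hℓG : ∀ e, 0 ≤ ℓG e)
    (Λf Λg : Finset (Edge 3 L)) (hΛf : ∀ e, e ∉ Λf → ℓF e = 0) (hΛg : ∀ e, e ∉ Λg → ℓG e = 0) (R : ℕ)
    (hsep : ∀ e' ∈ Λf, ∀ e ∈ Λg, R + 1 ≤ (Finset.univ.sup fun i : Fin 3 => ((e'.1 i - e.1 i).valMinAbs).natAbs))
    (t : ℝ≥0) (x : (GaugeConfig 3 L (Matrix.specialUnitaryGroup (Fin 2) ℂ))) :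
    let coords : GaugeConfig 3 L (Matrix.specialUnitaryGroup (Fin 2) ℂ) → (Edge 3 L × Fin 2 × Fin 2 × Bool → ℝ) :=
      fun V q => (fun z : ℂ => if q.2.2.2 then z.im else z.re)
        ((fundamentalRep (Fin 2) (V q.1) : Matrix (Fin 2) (Fin 2) ℂ) q.2.1 q.2.2.1)
    (∀ (e : Edge 3 L) (y y' : (GaugeConfig 3 L (Matrix.specialUnitaryGroup (Fin 2) ℂ))), (∀ f', f' ≠ e → y f' = y' f') →
      |f (coords y) - f (coords y')| ≤ ℓF e * frobNorm ((y e : Matrix (Fin 2) (Fin 2) ℂ) - (y' e : Matrix (Fin 2) (Fin 2) ℂ))) →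
    (∀ (e : Edge 3 L) (y y' : (GaugeConfig 3 L (Matrix.specialUnitaryGroup (Fin 2) ℂ))), (∀ f', f' ≠ e → y f' = y' f') →
      |g (coords y) - g (coords y')| ≤ ℓG e * frobNorm ((y e : Matrix (Fin 2) (Fin 2) ℂ) - (y' e : Matrix (Fin 2) (Fin 2) ℂ))) →
    |(∫ y, f (coords y) * g (coords y) ∂(κ t x)) - (∫ y, f (coords y) ∂(κ t x)) * (∫ y, g (coords y) ∂(κ t x))| ≤
      96 * (t : ℝ) * Real.exp (2 * ((|β'| * (4 + 4 * Real.sqrt 2 + 12 * 108)) * (t : ℝ))) * ((2 : ℝ)⁻¹) ^ (R + 1) * (∑ e : Edge 3 L, ℓF e) * (∑ e : Edge 3 L, ℓG e) := by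
  intro coords hLf hLg
  have h1 := transition_covariance_abs_le_lightCone L β' κ hreal hf hℓF hg hℓG t x hLf hLg
  have h2 := overlapSum_le_of_separated (L := L) hℓF hℓG Λf Λg hΛf hΛg R hsep
  have h0 : 0 ≤ 16 * (t : ℝ) * Real.exp (2 * ((|β'| * (4 + 4 * Real.sqrt 2 + 12 * 108)) * (t : ℝ))) := by positivity
  calc _ ≤ _ := h1
    _ ≤ 16 * (t : ℝ) * Real.exp (2 * ((|β'| * (4 + 4 * Real.sqrt 2 + 12 * 108)) * (t : ℝ))) * (6 * ((2 : ℝ)⁻¹) ^ (R + 1) * ((∑ e : Edge 3 L, ℓF e) * ∑ e : Edge 3 L, ℓG e)) :=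
        mul_le_mul_of_nonneg_left h2 h0
    _ = _ := by ring

/-! ## §5. Along every strong solution from a deterministic start (e.g. the cold start) -/

/-- ★★★ **Light cone for correlations ALONG EVERY SZZ SOLUTION from a deterministic start** (any filtered probability space, any flat
Brownian driver; EVERY coupling `β'`, every volume): with the notation of `transition_covariance_abs_le_lightCone_of_separated`,
`|E[F(U_t)G(U_t)] − E[F(U_t)]·E[G(U_t)]| ≤ 96·t·e^(2λt)·2^(−(R+1))·Σℓ^F·Σℓ^G`.  In particular along the COLD-START evolution `U_0 ≡ 1` of the
route: the product structure of the initial state survives outside the light cone.  Fixed cut-off; `UniformColdStartMixing` (24809) is NOT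
restated; the Yang–Mills mass gap is NOT proved. [folklore] -/
theorem solution_covariance_abs_le_lightCone_of_separated (L : ℕ) [NeZero L] (β' : ℝ) (t : ℝ≥0)
    (x₀ : (GaugeConfig 3 L (Matrix.specialUnitaryGroup (Fin 2) ℂ)))
    (Ω : Type) [MeasurableSpace Ω] (P : Measure Ω) [IsProbabilityMeasure P]
    (W : ℝ≥0 → Ω → (Edge 3 L × NoiseIdx 2 → ℝ)) (hW : IsFlatBrownian W P)
    (U : ℝ≥0 → Ω → (GaugeConfig 3 L (Matrix.specialUnitaryGroup (Fin 2) ℂ))) (hU0 : ∀ ω, U 0 ω = x₀)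
    (hU : (latticeLangevinDynamics (fundamentalLatticeRep 2) β').IsSolution (fundamentalRep (Fin 2)) hW.natFiltration P W U)
    {f : (Edge 3 L × Fin 2 × Fin 2 × Bool → ℝ) → ℝ} (hf : ContDiff ℝ 3 f) {ℓF : Edge 3 L → ℝ} (hℓF : ∀ e, 0 ≤ ℓF e)
    {g : (Edge 3 L × Fin 2 × Fin 2 × Bool → ℝ) → ℝ} (hg : ContDiff ℝ 3 g) {ℓG : Edge 3 L → ℝ} (hℓG : ∀ e, 0 ≤ ℓG e)
    (Λf Λg : Finset (Edge 3 L)) (hΛf : ∀ e, e ∉ Λf → ℓF e = 0) (hΛg : ∀ e, e ∉ Λg → ℓG e = 0) (R : ℕ)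
    (hsep : ∀ e' ∈ Λf, ∀ e ∈ Λg, R + 1 ≤ (Finset.univ.sup fun i : Fin 3 => ((e'.1 i - e.1 i).valMinAbs).natAbs)) :
    let coords : GaugeConfig 3 L (Matrix.specialUnitaryGroup (Fin 2) ℂ) → (Edge 3 L × Fin 2 × Fin 2 × Bool → ℝ) :=
      fun V q => (fun z : ℂ => if q.2.2.2 then z.im else z.re)
        ((fundamentalRep (Fin 2) (V q.1) : Matrix (Fin 2) (Fin 2) ℂ) q.2.1 q.2.2.1)
    (∀ (e : Edge 3 L) (y y' : (GaugeConfig 3 L (Matrix.specialUnitaryGroup (Fin 2) ℂ))), (∀ f', f' ≠ e → y f' = y' f') →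
      |f (coords y) - f (coords y')| ≤ ℓF e * frobNorm ((y e : Matrix (Fin 2) (Fin 2) ℂ) - (y' e : Matrix (Fin 2) (Fin 2) ℂ))) →
    (∀ (e : Edge 3 L) (y y' : (GaugeConfig 3 L (Matrix.specialUnitaryGroup (Fin 2) ℂ))), (∀ f', f' ≠ e → y f' = y' f') →
      |g (coords y) - g (coords y')| ≤ ℓG e * frobNorm ((y e : Matrix (Fin 2) (Fin 2) ℂ) - (y' e : Matrix (Fin 2) (Fin 2) ℂ))) →
    |(∫ ω, f (coords (U t ω)) * g (coords (U t ω)) ∂P) - (∫ ω, f (coords (U t ω)) ∂P) * (∫ ω, g (coords (U t ω)) ∂P)| ≤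
      96 * (t : ℝ) * Real.exp (2 * ((|β'| * (4 + 4 * Real.sqrt 2 + 12 * 108)) * (t : ℝ))) * ((2 : ℝ)⁻¹) ^ (R + 1) * (∑ e : Edge 3 L, ℓF e) * (∑ e : Edge 3 L, ℓG e) := by
  intro coords hLf hLg
  classical
  haveI := secondCountableTopology_su2
  haveI := borelSpace_config L
  obtain ⟨κ, hκ, -, hreal⟩ := exists_transitionKernel L β'
  haveI := hκ
  have h := transition_covariance_abs_le_lightCone_of_separated L β' κ hreal hf hℓF hg hℓG Λf Λg hΛf hΛg R hsep t x₀ hLf hLg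
  have hlaw : κ t x₀ = P.map (U t) := hreal t x₀ Ω P W hW U hU0 hU
  have hmU : Measurable (U t) := (hU.adapted t).mono (hW.natFiltration.le t) le_rfl
  have hco : Continuous coords := continuous_coords (L := L)
  have hFm : Measurable fun y : (GaugeConfig 3 L (Matrix.specialUnitaryGroup (Fin 2) ℂ)) => f (coords y) :=
    (hf.continuous.comp hco).measurable
  have hGm : Measurable fun y : (GaugeConfig 3 L (Matrix.specialUnitaryGroup (Fin 2) ℂ)) => g (coords y) :=
    (hg.continuous.comp hco).measurable
  have hFGm : Measurable fun y : (GaugeConfig 3 L (Matrix.specialUnitaryGroup (Fin 2) ℂ)) => f (coords y) * g (coords y) := hFm.mul hGm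
  have e1 : ∫ y, f (coords y) * g (coords y) ∂(κ t x₀) = ∫ ω, f (coords (U t ω)) * g (coords (U t ω)) ∂P := by
    rw [hlaw, integral_map hmU.aemeasurable hFGm.aestronglyMeasurable]
  have e2 : ∫ y, f (coords y) ∂(κ t x₀) = ∫ ω, f (coords (U t ω)) ∂P := by
    rw [hlaw, integral_map hmU.aemeasurable hFm.aestronglyMeasurable]
  have e3 : ∫ y, g (coords y) ∂(κ t x₀) = ∫ ω, g (coords (U t ω)) ∂P := by
    rw [hlaw, integral_map hmU.aemeasurable hGm.aestronglyMeasurable]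
  rw [← e1, ← e2, ← e3]
  exact h

end Summit.QuantumFields.YangMills.Theorems.ColdStartUniversality.LiebRobinson

end
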